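import Literature.AlgebraicGeometry.Motives.HodgeThetaSubalgebraUnitaryThreeCoprime
import HarnessLib

/-!
# The `Θ`-subalgebra theorem in rank fourteen, complex–Hermitian core: `𝔤_ℂ = 𝔰𝔭₁₄` unless `𝔤_ℂ` is in the
# plus-line (Mumford-type) position (Moonen–Zarhin 1999 Thm. (2.7), `g = 7`: «`Hg(X) = Sp_D(V,φ)`»; Tankeev, Ribet)

Family `hodge`, layer `Literature/AlgebraicGeometry/Motives` (abstract polarizable `ℚ`-Hodge structures; no geometry).
Research context: cell `pub-hodge-ring2` (HONEST FRAMING: research route conditional on HC_CM; not a corollary;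
Q11.4-sentence-2 already refuted in dim ≥ 3), Literature lane (lit gen 83, programme R63: simple abelian SEVENFOLDS with
`End⁰ = ℚ`, the last open shape of dimension `7`). UNCONDITIONAL Hodge–Lie linear algebra; theorems only, no definition, no
named fact (D-0026), no `sorry`. This is the rank-FOURTEEN twin of the tree's `HodgeThetaSubalgebraSymplecticRankTen`
(lit gen 67): §1–§4 of that file (conjugate operators, diagonalizability of self-adjoint operators, `p(BB̄) ∈ 𝔩`, the
any-rank `mem_spanC_of_skew_of_levi` and `plusLine_of_forall_scalar`) are imported by name; the ONLY new ingredient is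
the case analysis of the Levi line algebra in dimension `dim V^{1,0} = 7`, which needs — besides the rank-one criterion and
the scalar case — the HERMITIAN cores of the tree for the partitions `2+5`, `3+4`, `2+2+3` of `7`:
`UnitaryTwoOdd.eq_top'` (`HodgeThetaSubalgebraUnitaryTwoOddCore`, lit gen 83) and `UnitaryThreeCoprime.eq_top'`
(`HodgeThetaSubalgebraUnitaryThreeCoprimeCore`, lit gen 83), fed with the Hodge–Riemann form `i·ψ_ℂ(x, conj y)` on
`V^{1,0}`, for which the Levi line algebra is adjoint-closed (Deligne, LNM 900, I §3).

THE PRINTED THEOREM. B. Moonen, Yu. Zarhin, Math. Ann. 315 (1999), Thm. (2.7) [held `paper:arxiv-math_9901113` p0005]: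
«Let `X` be a simple complex abelian variety such that `dim(X)` is a prime number. Then `Hg(X) = Sp_D(V,φ)` and
`B•(Xⁿ) = D•(Xⁿ)` for every `n ≥ 1`» (Tankeev; Ribet 1983 Thms. 1–2). Here `g = 7`, `End⁰ = ℚ`: `Hg = Sp₁₄`.

* §1 `SymplecticThetaFourteen.finrank_pieces_eq_seven` — `dim V = 14 ⟹ dim V^{1,0} = dim V^{0,1} = 7`.
* §2 **`SymplecticThetaFourteen.levi_eq_top_or_scalar`** — `dim V^{1,0} = 7`: the Levi line algebra is `End(V^{1,0})`
  or `BB̄|_{V^{1,0}}` is a scalar.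
* §3 **`SymplecticThetaFourteen.dichotomy`** — `dim V = 14`, `End_Hdg(V) = ℚ`: `𝔤_ℂ = 𝔰𝔭(V,ψ)_ℂ` OR the plus-line position
  (excluded arithmetically in the sequel `HodgeLieWeightOneRankFourteenSymplectic`: a twin `𝔰𝔩₂`-ideal forces `4 ∣ 14`).

## References
* [MoonenZarhin1999LowDim] B. Moonen, Yu. Zarhin, Math. Ann. 315 (1999), §2 p. 715, (2.3)–(2.7).
* [Ribet1983] K. A. Ribet, *Hodge classes on certain types of abelian varieties*, Amer. J. Math. 105 (1983), Thm. 1, Thm. 3.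
* [Deligne1982HodgeCycles] P. Deligne, *Hodge cycles on abelian varieties*, LNM 900 (1982), I §3 (Prop. 3.4, 3.6).
* [Mumford1969NoteShimura] D. Mumford, Math. Ann. 181 (1969), §4.
* [HoffmanKunze1971LinearAlgebra] K. Hoffman, R. Kunze, *Linear Algebra* (1971), §6.7 Thm. 11, §8.5, §9.5.
* [GoodmanWallachGTM255] R. Goodman, N. R. Wallach, GTM 255 (2009), §2.1.2, §4.1.1.
* [Gordon1997] B. B. Gordon, *A survey of the Hodge conjecture for abelian varieties*, §6 (proof of Thm. 6.3.3).
-/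

noncomputable section

open scoped TensorProduct
open Polynomial

namespace Literature.AlgebraicGeometry.Motives

namespace HodgeStructure

universe u

/-! ### §1 Dimensions -/

section Levi

variable {V : Type u} [AddCommGroup V] [Module ℚ V] {n : ℤ}

/-- `dim V^{1,0} = dim V^{0,1} = 7` for an effective weight-one Hodge structure of rank fourteen.
[cite: MoonenZarhin1999LowDim, §2 p. 715] -/
theorem SymplecticThetaFourteen.finrank_pieces_eq_seven [Module.Finite ℚ V] (H : HodgeStructure V n) (hn : n = 1)
    (heff : H.IsEffective) (hV : Module.finrank ℚ V = 14) {Θ : Module.End ℂ (ℂ ⊗[ℚ] V)}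
    (hΘ : ∀ p, ∀ x ∈ H.piece p (n - p), Θ x = ((2 * p - n : ℤ) : ℂ) • x) :
    Module.finrank ℂ (H.piece 1 0) = 7 ∧ Module.finrank ℂ (H.piece 0 1) = 7 := by
  subst hn
  obtain ⟨hP, hQ, hΘ10, hΘ01, -⟩ := UnitaryTheta.theta_facts H rfl heff hΘ
  have hPQ : ∀ v, (2 : ℂ)⁻¹ • (v + Θ v) + (2 : ℂ)⁻¹ • (v - Θ v) = v := fun v => by module
  have hsup : H.piece 1 0 ⊔ H.piece 0 1 = ⊤ := by
    rw [eq_top_iff]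
    intro v _
    rw [← hPQ v]
    exact Submodule.add_mem_sup (hP v) (hQ v)
  have hinf : H.piece 1 0 ⊓ H.piece 0 1 = ⊥ := by
    rw [eq_bot_iff]
    intro x hx
    rw [Submodule.mem_bot]
    have h1 := hΘ10 x hx.1
    rw [hΘ01 x hx.2, neg_eq_iff_add_eq_zero, ← two_smul ℂ x, smul_eq_zero] at h1
    exact h1.resolve_left (two_ne_zero' ℂ)
  have hsum := Submodule.finrank_sup_add_finrank_inf_eq (H.piece 1 0) (H.piece 0 1)
  rw [hsup, hinf, finrank_top, finrank_bot, add_zero, Module.finrank_baseChange, hV] at hsum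
  have hsymm : Module.finrank ℂ (H.piece 1 0) = Module.finrank ℂ (H.piece 0 1) := hodgeNumber_symm_holds H 1 0
  omega

/-! ### §2 The Levi line algebra in dimension seven -/

set_option maxHeartbeats 800000 in
/-- **The Levi line algebra in dimension seven: everything, or `B B̄|_{V^{1,0}}` is a scalar.**
Let `H` be an effective polarized weight-one `ℚ`-Hodge structure with `End_Hdg(V) = ℚ` and `dim V^{1,0} = 7`,
`𝔤 ⊆ End_ℚ(V)` bracket-closed and `ψ`-skew with `Θ ∈ 𝔤_ℂ`, `B ∈ 𝔤_ℂ` raising with conjugate `B̄`. Then EITHER every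
endomorphism of `V^{1,0}` is the restriction of an element of `𝔤_ℂ`, OR `B B̄` acts on `V^{1,0}` as a scalar. PROOF (as in
`SymplecticThetaTen.levi_eq_top_or_scalar`, dimension `5`): `B B̄|_{V^{1,0}}` is self-adjoint for the definite pairing
`ψ_ℂ(x, conj y)`, hence diagonalizable with real spectrum and spectral projectors `E_c ∈ 𝔩`; the multiplicities sum to
`7`. A multiplicity `1` gives a rank-one idempotent (`SymplecticThetaSix.eq_top_of_rankOne_idempotent`); a multiplicity
`2` (resp. `3`) gives the involution `1 − 2E_c ∈ 𝔩` with eigenspaces of dimensions `5|2` (resp. `4|3`), `s`-orthogonal,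
and `𝔩 = End` by the Hermitian cores `UnitaryTwoOdd.eq_top'` (resp. `UnitaryThreeCoprime.eq_top'`) — `𝔩` being closed
under the adjoint `Z ↦ −Z̄₀` for `i·ψ_ℂ(x, conj y)` (Deligne: `ad C` is a Cartan involution); otherwise all
multiplicities are `≥ 4` and there is a single eigenvalue. The partitions of `7` into parts `≥ 2` being `7`, `2+5`,
`3+4`, `2+2+3`, this is exhaustive.
[cite: MoonenZarhin1999LowDim, §2 p. 715 and (2.4)–(2.7)] [cite: Ribet1983, Thm. 1 and Thm. 3]
[cite: HoffmanKunze1971LinearAlgebra, §6.7 Thm. 11, §8.5] [cite: Deligne1982HodgeCycles, I §3 Prop. 3.4, 3.6] -/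
theorem SymplecticThetaFourteen.levi_eq_top_or_scalar [Module.Finite ℚ V] (H : HodgeStructure V n) (hn : n = 1)
    (heff : H.IsEffective) (ψ : H.Polarization) (hE : ∀ a ∈ H.endAlg, ∃ x : ℚ, a = x • 1)
    (𝔤 : Submodule ℚ (Module.End ℚ V)) (hbr : ∀ X ∈ 𝔤, ∀ X' ∈ 𝔤, X * X' - X' * X ∈ 𝔤)
    {Θ : Module.End ℂ (ℂ ⊗[ℚ] V)} (hΘ : ∀ p, ∀ x ∈ H.piece p (n - p), Θ x = ((2 * p - n : ℤ) : ℂ) • x)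
    (hΘ𝔤 : Θ ∈ spanC 𝔤) (hskew : ∀ X ∈ 𝔤, ∀ v w, ψ.form (X v) w + ψ.form v (X w) = 0)
    (hP7 : Module.finrank ℂ (H.piece 1 0) = 7) {B C : Module.End ℂ (ℂ ⊗[ℚ] V)} (hB𝔤 : B ∈ spanC 𝔤)
    (hBP : ∀ p ∈ H.piece 1 0, B p = 0) (hBim : ∀ v, B v ∈ H.piece 1 0) (hC : ∀ v, C v = conj (B (conj v))) :
    (∀ A : Module.End ℂ ↥(H.piece 1 0), ∃ Z ∈ spanC 𝔤, ∀ p : ↥(H.piece 1 0),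
        ((A p : ↥(H.piece 1 0)) : ℂ ⊗[ℚ] V) = Z p) ∨
      ∃ μ : ℂ, ∀ p ∈ H.piece 1 0, B (C p) = μ • p := by
  classical
  have haeval := SymplecticThetaTen.aeval_mem_levi H hn heff 𝔤 hbr hΘ hΘ𝔤 hB𝔤 hBP hBim hC
  have hirr : ∀ U : Submodule ℂ (ℂ ⊗[ℚ] V), (∀ Z ∈ spanC 𝔤, ∀ u ∈ U, Z u ∈ U) → U = ⊥ ∨ U = ⊤ :=
    fun U hU => SymplecticTheta.eq_bot_or_top_of_stable H hn heff ψ hE 𝔤 hΘ hΘ𝔤 hskew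
      fun X hX u hu => hU _ (baseChange_mem_spanC hX) u hu
  subst hn
  obtain ⟨hPmem, hQmem, hΘ10, hΘ01, hΘΘ⟩ := UnitaryTheta.theta_facts H rfl heff hΘ
  set P := H.piece 1 0 with hPdef
  set Q := H.piece 0 1 with hQdef
  set M := ℂ ⊗[ℚ] V
  set ω := ψ.form.baseChange ℂ with hω
  have h𝔊br : ∀ Z ∈ spanC 𝔤, ∀ Z' ∈ spanC 𝔤, Z * Z' - Z' * Z ∈ spanC 𝔤 := fun Z hZ Z' hZ' =>
    commutator_mem_spanC hbr hZ hZ'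
  have hBskew : ∀ x y, ω (B x) y + ω x (B y) = 0 := fun x y =>
    ThetaSubalgebra.formBaseChange_add_eq_zero_of_mem_spanC ψ hskew hB𝔤 x y
  -- the Levi line algebra `𝔩 ⊆ End(P)`
  let 𝔩 : Submodule ℂ (Module.End ℂ ↥P) :=
    { carrier := {A | ∃ Z ∈ spanC 𝔤, ∀ p : ↥P, ((A p : ↥P) : M) = Z p}
      zero_mem' := ⟨0, Submodule.zero_mem _, fun p => by simp⟩
      add_mem' := by
        rintro A A' ⟨Z, hZ, hAZ⟩ ⟨Z', hZ', hAZ'⟩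
        exact ⟨Z + Z', Submodule.add_mem _ hZ hZ', fun p => by
          rw [LinearMap.add_apply, Submodule.coe_add, hAZ, hAZ', LinearMap.add_apply]⟩
      smul_mem' := by
        rintro c A ⟨Z, hZ, hAZ⟩
        exact ⟨c • Z, Submodule.smul_mem _ _ hZ, fun p => by
          rw [LinearMap.smul_apply, Submodule.coe_smul, hAZ, LinearMap.smul_apply]⟩ }
  have hmem𝔩 : ∀ A, A ∈ 𝔩 ↔ ∃ Z ∈ spanC 𝔤, ∀ p : ↥P, ((A p : ↥P) : M) = Z p := fun A => Iff.rfl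
  have h𝔩br : ∀ A ∈ 𝔩, ∀ A' ∈ 𝔩, A * A' - A' * A ∈ 𝔩 := by
    intro A hA A' hA'
    obtain ⟨Z, hZ, hAZ⟩ := (hmem𝔩 A).1 hA
    obtain ⟨Z', hZ', hAZ'⟩ := (hmem𝔩 A').1 hA'
    refine (hmem𝔩 _).2 ⟨Z * Z' - Z' * Z, h𝔊br _ hZ _ hZ', fun p => ?_⟩
    rw [LinearMap.sub_apply, Submodule.coe_sub, Module.End.mul_apply, Module.End.mul_apply, hAZ, hAZ', hAZ',
      hAZ, LinearMap.sub_apply, Module.End.mul_apply, Module.End.mul_apply]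
  have h𝔩1 : (1 : Module.End ℂ ↥P) ∈ 𝔩 :=
    (hmem𝔩 _).2 ⟨Θ, hΘ𝔤, fun p => by rw [Module.End.one_apply, hΘ10 p p.2]⟩
  have h𝔩irr : ∀ U : Submodule ℂ ↥P, (∀ A ∈ 𝔩, ∀ u ∈ U, A u ∈ U) → U = ⊥ ∨ U = ⊤ := by
    intro U hU
    refine SymplecticThetaSix.levi_irreducible (spanC 𝔤) h𝔊br hΘ𝔤 hΘΘ hΘ10 hΘ01 hPmem hQmem hirr U
      fun Z hZ hZP u hu => ?_
    exact hU _ ((hmem𝔩 _).2 ⟨Z, hZ, fun p => rfl⟩) u hu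
  -- `A = B B̄|_P` and its polynomials
  have hBCP : ∀ x ∈ P, (B * C) x ∈ P := fun x _ => hBim _
  set A : Module.End ℂ ↥P := (B * C).restrict hBCP with hAdef
  have hAapply : ∀ p : ↥P, ((A p : ↥P) : M) = B (C p) := fun p => rfl
  have hA𝔩 : ∀ f : ℂ[X], aeval A f ∈ 𝔩 := by
    intro f
    obtain ⟨Z, hZ, hZf⟩ := haeval f
    exact (hmem𝔩 _).2 ⟨Z, hZ, fun p => by rw [UnitaryThetaCore.aeval_restrict_coe hBCP f p, hZf p p.2]⟩
  -- the definite pairing `s(x, y) = ψ_ℂ(x, conj y)` on `P`, for which `A` is self-adjoint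
  let s : ↥P → ↥P → ℂ := fun x y => ω (x : M) (conj (y : M))
  have hs : ∀ x y : ↥P, s x y = ω (x : M) (conj (y : M)) := fun x y => rfl
  have hsadd₁ : ∀ x y z : ↥P, s (x + y) z = s x z + s y z := fun x y z => by
    rw [hs, hs, hs, Submodule.coe_add, map_add, LinearMap.add_apply]
  have hssmul₁ : ∀ (c : ℂ) (x z : ↥P), s (c • x) z = c * s x z := fun c x z => by
    rw [hs, hs, Submodule.coe_smul, map_smul, LinearMap.smul_apply, smul_eq_mul]
  have hsadd₂ : ∀ x y z : ↥P, s x (y + z) = s x y + s x z := fun x y z => by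
    rw [hs, hs, hs, Submodule.coe_add, map_add, map_add]
  have hssmul₂ : ∀ (c : ℂ) (x y : ↥P), s x (c • y) = starRingEnd ℂ c * s x y := fun c x y => by
    rw [hs, hs, Submodule.coe_smul, conj_smul, map_smul, smul_eq_mul]
  have hsdef : ∀ x : ↥P, s x x = 0 → x = 0 := by
    intro x hx
    by_contra hx0
    have hx0' : (x : M) ≠ 0 := fun h => hx0 (Subtype.ext h)
    exact ψ.form_conj_ne_zero (p := 1) (q := 0) (by norm_num) x.2 hx0' hx
  have hAsa : ∀ x y : ↥P, s (A x) y = s x (A y) := fun x y => by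
    rw [hs, hs, hAapply, hAapply]
    exact (SymplecticThetaTen.form_mul_conjOp_conj ψ.form hC hBskew (x : M) (y : M)).1
  obtain ⟨hreal, -, htop⟩ := SymplecticThetaTen.iSup_eigenspace_eq_top_of_selfAdjoint s hsadd₁ hssmul₁ hsadd₂ hssmul₂
    hsdef A hAsa
  -- the spectral resolution of `A`
  have hdiag := (Literature.LinearAlgebra.exists_basis_toMatrix_eq_diagonal_iff_iSup_eigenspace_eq_top A).2 htop
  obtain ⟨E, hElag, hAsum, hEsum, hEorth, hEidem, hErange, hEne⟩ :=
    Literature.LinearAlgebra.exists_resolution_of_diagonalizable A hdiag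
  set S := A.finite_hasEigenvalue.toFinset with hSdef
  have hE𝔩 : ∀ c, E c ∈ 𝔩 := fun c => by rw [hElag c]; exact hA𝔩 _
  have hEapply_mem : ∀ c ∈ S, ∀ x : ↥P, E c x ∈ A.eigenspace c := fun c hc x => by
    rw [← hErange c hc]; exact LinearMap.mem_range_self _ _
  -- dimension count `Σ_{c ∈ S} dim Eig_c = 7`
  set d : ℂ → ℕ := fun c => Module.finrank ℂ ↥(A.eigenspace c) with hddef
  have hbiSup : ⨆ c ∈ S, A.eigenspace c = ⊤ := by
    rw [eq_top_iff]
    intro x _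
    rw [Literature.LinearAlgebra.eq_sum_resolution_apply hEsum x]
    refine Submodule.sum_mem _ fun c hc => ?_
    exact Submodule.mem_iSup_of_mem c (Submodule.mem_iSup_of_mem hc (hEapply_mem c hc x))
  have hdsum : ∑ c ∈ S, d c = 7 := by
    have h := Literature.LinearAlgebra.finrank_biSup_eigenspace_eq_sum A S
    rw [hbiSup, finrank_top, hP7] at h
    exact h.symm
  have hdpos : ∀ c ∈ S, 1 ≤ d c := by
    intro c hc
    rw [Nat.one_le_iff_ne_zero]
    intro h0
    have hbot : A.eigenspace c = ⊥ := Submodule.finrank_eq_zero.1 h0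
    apply hEne c hc
    refine LinearMap.ext fun x => ?_
    have hx := hEapply_mem c hc x
    rw [hbot, Submodule.mem_bot] at hx
    rw [hx, LinearMap.zero_apply]
  -- CASE 1: a simple eigenvalue gives a rank-one idempotent in `𝔩`
  by_cases h1 : ∃ c ∈ S, d c = 1
  · left
    obtain ⟨c, hc, hdc⟩ := h1
    obtain ⟨u, hu, hu0⟩ : ∃ u ∈ A.eigenspace c, u ≠ 0 := by
      have hne : A.eigenspace c ≠ ⊥ := fun h => by
        have : d c = 0 := by
          show Module.finrank ℂ ↥(A.eigenspace c) = 0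
          rw [h, finrank_bot]
        omega
      exact (Submodule.ne_bot_iff _).1 hne
    have hdc' : Module.finrank ℂ ↥(A.eigenspace c) = 1 := hdc
    have hline : ∀ w ∈ A.eigenspace c, ∃ r : ℂ, r • u = w := by
      intro w hw
      have hu0' : (⟨u, hu⟩ : ↥(A.eigenspace c)) ≠ 0 := fun h => hu0 (congrArg Subtype.val h)
      obtain ⟨r, hr⟩ := (finrank_eq_one_iff_of_nonzero' (⟨u, hu⟩ : ↥(A.eigenspace c)) hu0').1 hdc' ⟨w, hw⟩
      exact ⟨r, congrArg Subtype.val hr⟩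
    have hπu : E c u = u := by
      obtain ⟨y, hy⟩ : u ∈ LinearMap.range (E c) := by rw [hErange c hc]; exact hu
      rw [← hy, ← Module.End.mul_apply, hEidem c hc]
    obtain ⟨ℓ, hℓ⟩ := Module.Projective.exists_dual_eq_one ℂ hu0
    set φ : Module.Dual ℂ ↥P := ℓ ∘ₗ E c with hφdef
    have hφu : φ u = 1 := by rw [hφdef, LinearMap.comp_apply, hπu, hℓ]
    have hπeq : φ.smulRight u = E c := by
      refine LinearMap.ext fun x => ?_
      obtain ⟨r, hr⟩ := hline _ (hEapply_mem c hc x)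
      rw [LinearMap.smulRight_apply, hφdef, LinearMap.comp_apply, ← hr, map_smul, hℓ, smul_eq_mul, mul_one]
    have he : φ.smulRight u ∈ 𝔩 := by rw [hπeq]; exact hE𝔩 c
    have htop𝔩 := SymplecticThetaSix.eq_top_of_rankOne_idempotent 𝔩 h𝔩br h𝔩1 h𝔩irr hφu he
    intro A'
    exact (hmem𝔩 A').1 (htop𝔩 ▸ Submodule.mem_top)
  · push Not at h1
    have hd2 : ∀ c ∈ S, 2 ≤ d c := fun c hc => by
      have h := hdpos c hc; have h' := h1 c hc; omega
    have hcard0 : S.card ≠ 0 := by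
      intro h0
      rw [Finset.card_eq_zero] at h0
      rw [h0, Finset.sum_empty] at hdsum
      omega
    -- the Hermitian form `s' = i·s` (Hodge–Riemann) for the cores with Hermitian data
    have hΘΘ' : Θ * Θ = 1 := LinearMap.ext fun v => by rw [Module.End.mul_apply, hΘΘ, Module.End.one_apply]
    have hωalt : ∀ x y : M, ω y x = -ω x y := fun x y => by
      rw [hω, ψ.form_baseChange_swap y x, Int.negOnePow_odd 1 odd_one]
      norm_num
    let s' : ↥P → ↥P → ℂ := fun x y => Complex.I * s x y
    have hs' : ∀ x y : ↥P, s' x y = Complex.I * ω (x : M) (conj (y : M)) := fun x y => rfl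
    have hadd' : ∀ x y z : ↥P, s' (x + y) z = s' x z + s' y z := fun x y z => by
      rw [hs', hs', hs', Submodule.coe_add, map_add, LinearMap.add_apply, mul_add]
    have hsmul₁' : ∀ (c : ℂ) (x z : ↥P), s' (c • x) z = c * s' x z := fun c x z => by
      rw [hs', hs', Submodule.coe_smul, map_smul, LinearMap.smul_apply, smul_eq_mul]; ring
    have hsmul₂' : ∀ (c : ℂ) (x y : ↥P), s' x (c • y) = starRingEnd ℂ c * s' x y := fun c x y => by
      rw [hs', hs', Submodule.coe_smul, conj_smul, map_smul, smul_eq_mul]; ring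
    have hsymm' : ∀ x y : ↥P, s' y x = starRingEnd ℂ (s' x y) := fun x y => by
      rw [hs', hs', map_mul, Complex.conj_I, ← form_baseChange_conj, conj_conj, hωalt, neg_mul, mul_neg]
    have hdef' : ∀ x : ↥P, s' x x = 0 → x = 0 := fun x hx =>
      hsdef x ((mul_eq_zero.1 hx).resolve_left Complex.I_ne_zero)
    have hAsa' : ∀ x y : ↥P, s' (A x) y = s' x (A y) := fun x y => by
      show Complex.I * s (A x) y = Complex.I * s x (A y)
      rw [hAsa]
    -- distinct eigenspaces of `A` are `s'`-orthogonal (the eigenvalues are real)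
    have horth : ∀ a ∈ S, ∀ b ∈ S, a ≠ b → ∀ x ∈ A.eigenspace a, ∀ y ∈ A.eigenspace b, s' x y = 0 := by
      intro a ha b hb hab x hx y hy
      have hAx : A x = a • x := Module.End.mem_eigenspace_iff.1 hx
      have hAy : A y = b • y := Module.End.mem_eigenspace_iff.1 hy
      have hbreal : starRingEnd ℂ b = b := hreal b (A.finite_hasEigenvalue.mem_toFinset.1 hb)
      have h := hAsa' x y
      rw [hAx, hAy, hsmul₁', hsmul₂', hbreal] at h
      have h' : (a - b) * s' x y = 0 := by rw [sub_mul, h, sub_self]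
      exact (mul_eq_zero.1 h').resolve_left (sub_ne_zero.2 hab)
    have hsum' : ∀ (f : ℂ → ↥P) (T : Finset ℂ) (y : ↥P), s' (∑ c ∈ T, f c) y = ∑ c ∈ T, s' (f c) y := by
      intro f T y
      induction T using Finset.induction_on with
      | empty =>
        rw [Finset.sum_empty, Finset.sum_empty, hs', Submodule.coe_zero, map_zero, LinearMap.zero_apply, mul_zero]
      | insert c T hc ih => rw [Finset.sum_insert hc, Finset.sum_insert hc, hadd', ih]
    -- `𝔩` is closed under `s'`-adjoints: the adjoint of `Z|_P` is `−(conj ∘ Z₀ ∘ conj)|_P`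
    have hadj𝔩 : ∀ A₁ ∈ 𝔩, ∃ A₂ ∈ 𝔩, ∀ x y : ↥P, s' (A₁ x) y = s' x (A₂ y) := by
      intro A₁ hA₁
      obtain ⟨Z, hZ, hA₁Z⟩ := (hmem𝔩 A₁).1 hA₁
      have hZ₀ := UnitaryThetaCore.zero_mem h𝔊br hΘ𝔤 hΘΘ' hZ
      obtain ⟨-, hΘZ₀⟩ := UnitaryThetaCore.decomp hΘΘ' Z
      set Z₀ : Module.End ℂ M := (2 : ℂ)⁻¹ • (Z + Θ * Z * Θ) with hZ₀def
      have hZP : ∀ p : ↥P, Z p ∈ P := fun p => by rw [← hA₁Z p]; exact (A₁ p).2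
      have hZ₀P : ∀ p : ↥P, Z₀ p = Z p := fun p => by
        rw [hZ₀def, LinearMap.smul_apply, LinearMap.add_apply, Module.End.mul_apply, Module.End.mul_apply,
          hΘ10 _ p.2, hΘ10 _ (hZP p)]
        module
      have hZ₀Q : ∀ q ∈ Q, Z₀ q ∈ Q := fun q hq => by
        have h : Θ (Z₀ q) = -(Z₀ q) := by
          rw [← Module.End.mul_apply, hΘZ₀, Module.End.mul_apply, hΘ01 q hq, map_neg]
        have h' : Z₀ q = (2 : ℂ)⁻¹ • (Z₀ q - Θ (Z₀ q)) := by rw [h]; module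
        rw [h']
        exact hQmem _
      obtain ⟨Zb, hZb⟩ := exists_conjOp Z₀
      have hZb𝔤 : Zb ∈ spanC 𝔤 := conjOp_mem_spanC hZ₀ hZb
      have hZbP : ∀ p ∈ P, (-Zb) p ∈ P := fun p hp => by
        rw [LinearMap.neg_apply, hZb]
        exact Submodule.neg_mem _ (conj_mem_piece H (hZ₀Q _ (conj_mem_piece H hp)))
      refine ⟨(-Zb).restrict hZbP, (hmem𝔩 _).2 ⟨-Zb, Submodule.neg_mem _ hZb𝔤, fun p => rfl⟩, fun x y => ?_⟩
      have hskZ₀ : ∀ a b, ω (Z₀ a) b = -ω a (Z₀ b) := fun a b =>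
        eq_neg_of_add_eq_zero_left (ThetaSubalgebra.formBaseChange_add_eq_zero_of_mem_spanC ψ hskew hZ₀ a b)
      have hconjZb : conj (Zb y) = Z₀ (conj (y : M)) := by rw [hZb, conj_conj]
      have h2 : (((-Zb).restrict hZbP y : ↥P) : M) = -(Zb y) := rfl
      rw [hs', hs', hA₁Z, ← hZ₀P, hskZ₀, h2, map_neg, hconjZb, map_neg]
    -- an eigenvalue of multiplicity `2` or `3` gives an involution `1 − 2E_z ∈ 𝔩` of type `(5|2)` or `(4|3)`
    have key : ∀ z ∈ S, (d z = 2 ∨ d z = 3) → 𝔩 = ⊤ := by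
      intro z hz hdz
      set Θ' : Module.End ℂ ↥P := 1 - (E z + E z) with hΘ'def
      have hzz := hEidem z hz
      have hEEv : ∀ v, E z (E z v) = E z v := fun v => by rw [← Module.End.mul_apply, hzz]
      have hΘ'apply : ∀ v, Θ' v = v - (E z v + E z v) := fun v => by
        rw [hΘ'def, LinearMap.sub_apply, Module.End.one_apply, LinearMap.add_apply]
      obtain ⟨Zz, hZz, hZzE⟩ := (hmem𝔩 _).1 (hE𝔩 z)
      have hΘ'𝔩 : Θ' ∈ 𝔩 := (hmem𝔩 _).2 ⟨Θ - (Zz + Zz), Submodule.sub_mem _ hΘ𝔤 (Submodule.add_mem _ hZz hZz),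
        fun p => by
          rw [hΘ'apply, Submodule.coe_sub, Submodule.coe_add, hZzE, LinearMap.sub_apply, LinearMap.add_apply,
            hΘ10 _ p.2]⟩
      have hΘ'sq : Θ' * Θ' = 1 := by
        refine LinearMap.ext fun v => ?_
        rw [Module.End.mul_apply, Module.End.one_apply, hΘ'apply, hΘ'apply, map_sub, map_add, hEEv]
        abel
      set P' : Submodule ℂ ↥P := LinearMap.ker (E z) with hP'def
      set Q' : Submodule ℂ ↥P := LinearMap.range (E z) with hQ'def
      have hP' : ∀ v, v ∈ P' ↔ Θ' v = v := fun v => by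
        rw [hP'def, LinearMap.mem_ker, hΘ'apply, sub_eq_self, ← two_smul ℂ, smul_eq_zero]
        exact ⟨fun h => Or.inr h, fun h => h.resolve_left two_ne_zero⟩
      have hQ' : ∀ v, v ∈ Q' ↔ Θ' v = -v := fun v => by
        rw [hQ'def, LinearMap.mem_range, hΘ'apply]
        constructor
        · rintro ⟨w, rfl⟩
          rw [hEEv]; abel
        · intro h
          have h' : v = -v + (E z v + E z v) := sub_eq_iff_eq_add.1 h
          have h2 : (2 : ℂ) • E z v = (2 : ℂ) • v := by
            rw [two_smul, two_smul]
            calc E z v + E z v = (-v + (E z v + E z v)) + v := by abel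
              _ = v + v := by rw [← h']
          exact ⟨v, smul_right_injective _ (two_ne_zero' ℂ) h2⟩
      have hfinQ' : Module.finrank ℂ Q' = d z := by
        show Module.finrank ℂ ↥(LinearMap.range (E z)) = Module.finrank ℂ ↥(A.eigenspace z)
        rw [hErange z hz]
      have hfinP' : Module.finrank ℂ P' = 7 - d z := by
        have h := LinearMap.finrank_range_add_finrank_ker (E z)
        rw [hP7] at h
        show Module.finrank ℂ ↥(LinearMap.ker (E z)) = 7 - d z
        rw [← hfinQ']
        show Module.finrank ℂ ↥(LinearMap.ker (E z)) = 7 - Module.finrank ℂ ↥(LinearMap.range (E z))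
        omega
      have hP'Q' : ∀ p ∈ P', ∀ q ∈ Q', s' p q = 0 := by
        intro p hp q hq
        have hq' : q ∈ A.eigenspace z := by rw [← hErange z hz]; exact hq
        have hpz : E z p = 0 := LinearMap.mem_ker.1 hp
        rw [Literature.LinearAlgebra.eq_sum_resolution_apply hEsum p, hsum']
        refine Finset.sum_eq_zero fun c hc => ?_
        by_cases hcz : c = z
        · rw [hcz, hpz, hs', Submodule.coe_zero, map_zero, LinearMap.zero_apply, mul_zero]
        · exact horth c hc z hz hcz _ (hEapply_mem c hc p) _ hq'
      have hdefP' : ∀ p ∈ P', s' p p = 0 → p = 0 := fun p _ h => hdef' p h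
      have hdefQ' : ∀ q ∈ Q', s' q q = 0 → q = 0 := fun q _ h => hdef' q h
      rcases hdz with h2 | h3
      · have hodd : Odd (Module.finrank ℂ P') := by rw [hfinP', h2]; exact ⟨2, rfl⟩
        have hq2 : Module.finrank ℂ Q' = 2 := by rw [hfinQ', h2]
        exact UnitaryTwoOdd.eq_top' (𝔊 := 𝔩) (Θ := Θ') (P := P') (Q := Q') (s := s') h𝔩br h𝔩irr hΘ'𝔩 hΘ'sq
          hP' hQ' hodd hq2 hadd' hsymm' hP'Q' hdefP' hdefQ' hadj𝔩
      · have hp3 : ¬ 3 ∣ Module.finrank ℂ P' := by rw [hfinP', h3]; omega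
        have hq3 : Module.finrank ℂ Q' = 3 := by rw [hfinQ', h3]
        exact UnitaryThreeCoprime.eq_top' (𝔊 := 𝔩) (Θ := Θ') (P := P') (Q := Q') (s := s') h𝔩br h𝔩irr hΘ'𝔩
          hΘ'sq hP' hQ' hp3 hq3 hadd' hsymm' hP'Q' hdefP' hdefQ' hadj𝔩
    by_cases h2 : ∃ z ∈ S, d z = 2
    · left
      obtain ⟨z, hz, hdz⟩ := h2
      have htop𝔩 := key z hz (Or.inl hdz)
      intro A'
      exact (hmem𝔩 A').1 (htop𝔩 ▸ Submodule.mem_top)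
    by_cases h3 : ∃ z ∈ S, d z = 3
    · left
      obtain ⟨z, hz, hdz⟩ := h3
      have htop𝔩 := key z hz (Or.inr hdz)
      intro A'
      exact (hmem𝔩 A').1 (htop𝔩 ▸ Submodule.mem_top)
    -- CASE 3: all multiplicities `≥ 4`, hence a single eigenvalue: `A = c`
    push Not at h2 h3
    have hd4 : ∀ c ∈ S, 4 ≤ d c := fun c hc => by
      have h := hd2 c hc; have h' := h2 c hc; have h'' := h3 c hc; omega
    have hcard : S.card ≤ 1 := by
      have h := Finset.card_nsmul_le_sum S d 4 hd4
      rw [hdsum, smul_eq_mul] at h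
      omega
    right
    have hcard1 : S.card = 1 := by omega
    obtain ⟨c, hSc⟩ := Finset.card_eq_one.1 hcard1
    refine ⟨c, fun p hp => ?_⟩
    have hA1 : A = c • 1 := by
      rw [hSc, Finset.sum_singleton] at hAsum hEsum
      rw [hAsum, hEsum]
    have h := congrArg (fun T : Module.End ℂ ↥P => ((T ⟨p, hp⟩ : ↥P) : M)) hA1
    simpa only [hAapply, LinearMap.smul_apply, Module.End.one_apply, Submodule.coe_smul] using h

end Levi

/-! ### §3 The dichotomy in rank fourteen -/

section Main

variable {V : Type u} [AddCommGroup V] [Module ℚ V] {n : ℤ}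

/-- **THE DICHOTOMY IN RANK FOURTEEN.** Let `H` be an effective polarized weight-one `ℚ`-Hodge structure with
`dim V = 14` and `End_Hdg(V) = ℚ`, and `𝔤 ⊆ End_ℚ(V)` a bracket-closed `ℚ`-subspace of `ψ`-skew operators whose
complex span contains a Hodge operator `Θ`. Then EITHER every `ψ_ℂ`-skew operator of `V_ℂ` lies in `𝔤_ℂ`
(`𝔤_ℂ = 𝔰𝔭(V,ψ)_ℂ ≅ 𝔰𝔭₁₄` — Moonen–Zarhin Thm. (2.7), `g = 7`: «`Hg(X) = Sp_D(V,φ)`»), OR `𝔤_ℂ`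
is in the plus-line position of `plusLine_of_forall_scalar` (raising line `ℂB₀`, lowering line `ℂB̄₀`,
`B₀B̄₀ = μ₀ ≠ 0` on `V^{1,0}`, `B̄₀B₀ = μ₀` on `V^{0,1}` — the complexified shape `𝔰𝔩₂ ⊗ 1 ⊕ 1 ⊗ 𝔨` on
`ℂ² ⊗ ℂ⁷` of Mumford's examples, whose exclusion under `End_Hdg(V) = ℚ` is arithmetic).
[cite: MoonenZarhin1999LowDim, §2 p. 715 and (2.4)–(2.7)] [cite: Ribet1983, Thm. 1]
[cite: Mumford1969NoteShimura, §4] [cite: Deligne1982HodgeCycles, I §3 Prop. 3.4] -/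
theorem SymplecticThetaFourteen.dichotomy [Module.Finite ℚ V] (H : HodgeStructure V n) (hn : n = 1)
    (heff : H.IsEffective) (ψ : H.Polarization) (hE : ∀ a ∈ H.endAlg, ∃ x : ℚ, a = x • 1)
    (hV : Module.finrank ℚ V = 14) (𝔤 : Submodule ℚ (Module.End ℚ V))
    (hbr : ∀ X ∈ 𝔤, ∀ X' ∈ 𝔤, X * X' - X' * X ∈ 𝔤) {Θ : Module.End ℂ (ℂ ⊗[ℚ] V)}
    (hΘ : ∀ p, ∀ x ∈ H.piece p (n - p), Θ x = ((2 * p - n : ℤ) : ℂ) • x) (hΘ𝔤 : Θ ∈ spanC 𝔤)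
    (hskew : ∀ X ∈ 𝔤, ∀ v w, ψ.form (X v) w + ψ.form v (X w) = 0) :
    (∀ Y : Module.End ℂ (ℂ ⊗[ℚ] V),
        (∀ x y, ψ.form.baseChange ℂ (Y x) y + ψ.form.baseChange ℂ x (Y y) = 0) → Y ∈ spanC 𝔤) ∨
      ∃ B₀ ∈ spanC 𝔤, ∃ C₀ ∈ spanC 𝔤, ∃ μ₀ : ℂ,
        B₀ ≠ 0 ∧ (∀ p ∈ H.piece 1 0, B₀ p = 0) ∧ (∀ v, B₀ v ∈ H.piece 1 0) ∧
        (∀ v, C₀ v = conj (B₀ (conj v))) ∧ (∀ q ∈ H.piece 0 1, C₀ q = 0) ∧ (∀ v, C₀ v ∈ H.piece 0 1) ∧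
        μ₀ ≠ 0 ∧ starRingEnd ℂ μ₀ = μ₀ ∧
        (∀ p ∈ H.piece 1 0, B₀ (C₀ p) = μ₀ • p) ∧ (∀ q ∈ H.piece 0 1, C₀ (B₀ q) = μ₀ • q) ∧
        (∀ B ∈ spanC 𝔤, (∀ p ∈ H.piece 1 0, B p = 0) → (∀ v, B v ∈ H.piece 1 0) → ∃ c : ℂ, B = c • B₀) ∧
        (∀ C ∈ spanC 𝔤, (∀ q ∈ H.piece 0 1, C q = 0) → (∀ v, C v ∈ H.piece 0 1) → ∃ c : ℂ, C = c • C₀) := by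
  have hP7 := (SymplecticThetaFourteen.finrank_pieces_eq_seven H hn heff hV hΘ).1
  have hP0 : H.piece 1 0 ≠ ⊥ := fun h => by rw [h, finrank_bot] at hP7; exact absurd hP7 (by norm_num)
  by_cases hsc : ∀ B ∈ spanC 𝔤, (∀ p ∈ H.piece 1 0, B p = 0) → (∀ v, B v ∈ H.piece 1 0) →
      ∀ C : Module.End ℂ (ℂ ⊗[ℚ] V), (∀ v, C v = conj (B (conj v))) →
        ∃ μ : ℂ, ∀ p ∈ H.piece 1 0, B (C p) = μ • p
  · exact Or.inr (SymplecticThetaTen.plusLine_of_forall_scalar H hn heff ψ hE 𝔤 hbr hΘ hΘ𝔤 hskew hP0 hsc)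
  · left
    push Not at hsc
    obtain ⟨B, hB𝔤, hBP, hBim, C, hC, hnot⟩ := hsc
    rcases SymplecticThetaFourteen.levi_eq_top_or_scalar H hn heff ψ hE 𝔤 hbr hΘ hΘ𝔤 hskew hP7 hB𝔤 hBP hBim hC with
      hlevi | ⟨μ, hμ⟩
    · intro Y hY
      exact SymplecticThetaTen.mem_spanC_of_skew_of_levi H hn heff ψ hE 𝔤 hbr hΘ hΘ𝔤 hskew hP0 hlevi hY
    · obtain ⟨p, hp, hne⟩ := hnot μ
      exact absurd (hμ p hp) hne

end Main

end HodgeStructure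

end Literature.AlgebraicGeometry.Motives

end
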